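import Summits.Ventures.Crystal3D.Theorems.StickyWulffConstantCoaxialWallLawTransCell
import Summits.Ventures.Crystal3D.Theorems.StickyWulffConstantGenericWallFloorSlotFrameIdentity
import Summits.Ventures.Crystal3D.Theorems.StickyWulffConstantCoaxialWallLawTerracePropagation
import Summits.Ventures.Crystal3D.Theorems.StickyWulffConstantCoaxialWallLawInteriorLedger
import Summits.Ventures.Crystal3D.Theorems.StickyWulffConstantCoaxialWallLawHaggConst
import Summits.Ventures.Crystal3D.Theorems.StickyWulffConstantGenericWallFloorCoaxialIff
import Summits.Ventures.Crystal3D.Theorems.StickyWulffConstantGenericWallFloorSampleDeficitUpper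
import Summits.Ventures.Crystal3D.Theorems.StickyWulffConstantGenericWallFloorRigidRung
import Summits.Ventures.Crystal3D.Theorems.StickyWulffConstantNoReconstructionGainLatticeAdhesion
import HarnessLib

/-!
# The NET rung of `stub_coaxialTwoSlabAdhesion` for 3-ADICALLY GENERIC TRANSLATION pairs: an orientation-independent charge

HONEST FRAMING. Part of the venture `Summits/Ventures/Crystal3D` (cell `crystal3d-full`), helper
`--supports` the crux `CoaxialWallLaw` (stmt-Ventures-19481, `route-Ventures-StickyWulffConstant`),
REGISTERED line `WallLedgerF` (planner cf-p1 gen 16), open stub `stub_coaxialTwoSlabAdhesion`.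
RUNG CREDIT ONLY — this is NOT the stub.  Sibling of `coaxialTwoSlabAdhesion_general_twin_inPlane`
(`…InPlaneTwin`) for TRANSLATION pairs (`σ 0 = σ' 0`: both grains carry the same frame `G₀ ∈ {L, L∘R}` over the
shared Barlow frame) whose relative shift is 3-ADICALLY GENERIC: no vector `3^k (q − p)` (`p ∈ Λ₁`, `q ∈ Λ₂`,
`k ∈ ℕ`) is a difference of two points of `Λ₁`.  For such pairs NO line of 19481-p2's word automaton ever reaches
the top sample (the balls it visits lie in `Λ₁ + G₀(ℤ[1/3]·Λ₀)`, `…Triadic`), so the NET count has an EMPTY band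
and can be rooted at ANY rising slot; a slot of rise `≥ 1/√3` always exists (`Σ_w ⟪G₀ w, e₃⟫² = 4`,
`sum_slots_inner_sq_frame`), which makes the charge ORIENTATION-INDEPENDENT:

**Theorem (`coaxialTwoSlabAdhesion_general_trans_generic`).**  Under the crux's co-axiality data with
`σ 0 = σ' 0` and the genericity hypothesis: there are `C` and `R₀ = 10` such that for every `h ≥ 0`, `ρ ≥ R₀`,
every `1`-separated `X` in the cell with the two complete slab samples,

  `cross(P₁, X∖P₁) + cross(P₂, Y) ≤ D(Y) + (φ₁ + φ₂ − √6/17160) π ρ² + C (1 + h) ρ`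

— a charge `√6/17160 ≥ (√6/17160)·sin θ` at EVERY inclination, NO residual, h-uniform; inputs `KissingGap δ`,
`KissingClassification δ` by name.  (Incoherent translation walls — no coherent interface exists for a generic
shift — cost a positive amount per area whatever their orientation.)  Proof = the text of `…InPlaneTwin` with the
cell lemma `wordNet_trans_payers_ge_generic` (`…TransCell`).

WHAT THIS IS NOT: not the stub; translation pairs with a shift in `Λ₁ − Λ₁ + G₀(ℤ[1/3]Λ₀)` — in particular the
stacking-fault cosets, where coherent `{111}` terraces exist and the true cost is `∝ sin θ` — are NOT covered (there
the v1 residual form `coaxialTwoSlabAdhesion_general_trans_fluxGap` and the thin-wall law remain of record); F-C1 not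
moved.
-/

noncomputable section

namespace Summit.Ventures.Crystal3D.Theorems

open Summit.Ventures.Crystal3D Finset
open Literature.MathematicalPhysics.StatisticalMechanics (fccStacking barlowStacking IsHaggSeq
  contactDeficiency)
open scoped InnerProductSpace

open scoped Classical in
/-- **The NET rung for 3-adically generic translation pairs (orientation-independent charge).**  See the module
docstring. -/
theorem coaxialTwoSlabAdhesion_general_trans_generic {δ : ℝ} (hg : KissingGap δ) (hc : KissingClassification δ)
    (A₁ : EuclideanSpace ℝ (Fin 3) ≃ₗᵢ[ℝ] EuclideanSpace ℝ (Fin 3)) (t₁ : EuclideanSpace ℝ (Fin 3))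
    (A₂ : EuclideanSpace ℝ (Fin 3) ≃ₗᵢ[ℝ] EuclideanSpace ℝ (Fin 3)) (t₂ : EuclideanSpace ℝ (Fin 3))
    (L : EuclideanSpace ℝ (Fin 3) ≃ₗᵢ[ℝ] EuclideanSpace ℝ (Fin 3)) (s₁ s₂ : EuclideanSpace ℝ (Fin 3))
    (σ σ' : ℤ → ℤ) (hσ : IsHaggSeq σ) (hσ' : IsHaggSeq σ')
    (hsub₁ : (fun p => A₁ p + t₁) '' fccStacking 1 (Real.sqrt (2 / 3)) ⊆
      (fun p => L p + s₁) '' barlowStacking 1 (Real.sqrt (2 / 3)) σ)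
    (hsub₂ : (fun p => A₂ p + t₂) '' fccStacking 1 (Real.sqrt (2 / 3)) ⊆
      (fun p => L p + s₂) '' barlowStacking 1 (Real.sqrt (2 / 3)) σ')
    (htw : σ 0 = σ' 0)
    (hgen : ∀ k : ℕ, ∀ p ∈ (fun x => A₁ x + t₁) '' fccStacking 1 (Real.sqrt (2 / 3)),
      ∀ p' ∈ (fun x => A₁ x + t₁) '' fccStacking 1 (Real.sqrt (2 / 3)),
      ∀ q ∈ (fun x => A₂ x + t₂) '' fccStacking 1 (Real.sqrt (2 / 3)), ((3 : ℝ) ^ k) • (q - p) ≠ p' - p) :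
    ∃ C R₀ : ℝ, 1 ≤ R₀ ∧ ∀ h : ℝ, 0 ≤ h → ∀ ρ : ℝ, R₀ ≤ ρ →
      ∀ X P₁ P₂ : Finset (EuclideanSpace ℝ (Fin 3)),
      (∀ p ∈ X, ∀ q ∈ X, p ≠ q → 1 ≤ dist p q) → P₁ ⊆ X → P₂ ⊆ X \ P₁ →
      (∀ p ∈ X, -(2 * R₀) ≤ p 2 ∧ p 2 ≤ h + 2 * R₀ ∧ p 0 ^ 2 + p 1 ^ 2 ≤ ρ ^ 2) →
      (∀ p, p ∈ P₁ ↔ (p ∈ (fun q => A₁ q + t₁) '' fccStacking 1 (Real.sqrt (2 / 3)) ∧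
        -(2 * R₀) ≤ p 2 ∧ p 2 ≤ -R₀ ∧ p 0 ^ 2 + p 1 ^ 2 ≤ ρ ^ 2)) →
      (∀ p, p ∈ P₂ ↔ (p ∈ (fun q => A₂ q + t₂) '' fccStacking 1 (Real.sqrt (2 / 3)) ∧
        h + R₀ ≤ p 2 ∧ p 2 ≤ h + 2 * R₀ ∧ p 0 ^ 2 + p 1 ^ 2 ≤ ρ ^ 2)) →
      ((((P₁ ×ˢ (X \ P₁)).filter fun pq => dist pq.1 pq.2 = 1).card : ℕ) : ℝ) +
        ((((P₂ ×ˢ ((X \ P₁) \ P₂)).filter fun pq => dist pq.1 pq.2 = 1).card : ℕ) : ℝ) ≤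
        contactDeficiency ((X \ P₁) \ P₂) +
          (Real.sqrt 2 / 4 * ∑ᶠ w ∈ {w ∈ fccStacking 1 (Real.sqrt (2 / 3)) | ‖w‖ = 1},
              |⟪w, A₁.symm (EuclideanSpace.single (2 : Fin 3) (1 : ℝ))⟫_ℝ| +
            Real.sqrt 2 / 4 * ∑ᶠ w ∈ {w ∈ fccStacking 1 (Real.sqrt (2 / 3)) | ‖w‖ = 1},
              |⟪w, A₂.symm (EuclideanSpace.single (2 : Fin 3) (1 : ℝ))⟫_ℝ| -
            (Real.sqrt 6 / 17160 : ℝ)) * Real.pi * ρ ^ 2 +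
          C * (1 + h) * ρ := by
  set e₃ : EuclideanSpace ℝ (Fin 3) := EuclideanSpace.single (2 : Fin 3) (1 : ℝ) with he₃
  set RL : EuclideanSpace ℝ (Fin 3) ≃ₗᵢ[ℝ] EuclideanSpace ℝ (Fin 3) :=
    (ℝ ∙ EuclideanSpace.single (2 : Fin 3) (1 : ℝ)).reflection.trans L with hRL
  have hr : 0 < Real.sqrt (2 / 3) := Real.sqrt_pos.2 (by norm_num)
  have he₃1 : ‖e₃‖ = 1 := by rw [he₃, PiLp.norm_single, norm_one]
  obtain ⟨C₁, hC₁⟩ := affineSampleDeficit_upper A₁ t₁ 10 (by norm_num)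
  obtain ⟨C₂, hC₂⟩ := affineSampleDeficit_upper A₂ t₂ 10 (by norm_num)
  -- normal form: both grains are `G₀·Λ₀ + sᵢ` with `G₀ ∈ {L, L∘R}`
  have hnorm : ∃ G₀ : EuclideanSpace ℝ (Fin 3) ≃ₗᵢ[ℝ] EuclideanSpace ℝ (Fin 3),
      (fun q => A₁ q + t₁) '' fccStacking 1 (Real.sqrt (2 / 3)) =
        (fun q => G₀ q + s₁) '' fccStacking 1 (Real.sqrt (2 / 3)) ∧
      (fun q => A₂ q + t₂) '' fccStacking 1 (Real.sqrt (2 / 3)) =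
        (fun q => G₀ q + s₂) '' fccStacking 1 (Real.sqrt (2 / 3)) := by
    rcases hσ 0 with h1 | hm1
    · exact ⟨L, coaxial_frame_eq_fcc_of_one A₁ t₁ L s₁ hσ hsub₁ h1,
        coaxial_frame_eq_fcc_of_one A₂ t₂ L s₂ hσ' hsub₂ (htw ▸ h1)⟩
    · obtain ⟨e₁, -⟩ := coaxial_frame_eq_fcc_of_neg_one A₁ t₁ L s₁ hσ hsub₁ hm1
      obtain ⟨e₂, -⟩ := coaxial_frame_eq_fcc_of_neg_one A₂ t₂ L s₂ hσ' hsub₂ (htw ▸ hm1)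
      exact ⟨RL, e₁, e₂⟩
  obtain ⟨G₀, e₁, e₂⟩ := hnorm
  -- genericity in normal form
  have hgen' : ∀ k : ℕ, ∀ q ∈ fccStacking 1 (Real.sqrt (2 / 3)), ((3 : ℝ) ^ k) • (s₂ - s₁) ≠ G₀ q := by
    intro k q hq heq
    obtain ⟨w₀, hw₀⟩ : ∃ w₀, w₀ ∈ fccSlots := Finset.card_pos.1 (by rw [card_fccSlots]; norm_num)
    have hw₀Λ := mem_fcc_of_mem_fccSlots hw₀
    have hp : G₀ w₀ + s₁ ∈ (fun x => A₁ x + t₁) '' fccStacking 1 (Real.sqrt (2 / 3)) := by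
      rw [e₁]; exact ⟨w₀, hw₀Λ, rfl⟩
    have hp' : G₀ (w₀ + q) + s₁ ∈ (fun x => A₁ x + t₁) '' fccStacking 1 (Real.sqrt (2 / 3)) := by
      rw [e₁]; exact ⟨w₀ + q, fcc_add_site_mem hw₀Λ hq, rfl⟩
    have hq' : G₀ w₀ + s₂ ∈ (fun x => A₂ x + t₂) '' fccStacking 1 (Real.sqrt (2 / 3)) := by
      rw [e₂]; exact ⟨w₀, hw₀Λ, rfl⟩
    refine hgen k _ hp _ hp' _ hq' ?_
    rw [show G₀ w₀ + s₂ - (G₀ w₀ + s₁) = s₂ - s₁ by abel, heq, map_add]; abel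
  -- a slot of rise at least `1/√3`
  obtain ⟨u, huS, hu3⟩ : ∃ u ∈ fccSlots, 1 / Real.sqrt 3 ≤ (G₀ u) 2 := by
    by_contra hno
    push Not at hno
    have h3 : (0 : ℝ) < Real.sqrt 3 := Real.sqrt_pos.2 (by norm_num)
    have h13 : (1 / Real.sqrt 3) ^ 2 = 1 / 3 := by rw [div_pow, one_pow, Real.sq_sqrt (by norm_num)]
    have hlt : ∀ w ∈ fccSlots, ⟪G₀ w, e₃⟫_ℝ ^ 2 < 1 / 3 := by
      intro w hw
      have h1 := hno w hw
      have h2 := hno (-w) (neg_mem_fccSlots hw)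
      rw [map_neg, PiLp.neg_apply] at h2
      rw [← apply_two_eq_inner_e₃, ← h13, sq_lt_sq, abs_of_pos (by positivity : (0 : ℝ) < 1 / Real.sqrt 3)]
      exact abs_lt.2 ⟨by linarith, h1⟩
    have hsum := sum_slots_inner_sq_frame G₀ e₃
    rw [he₃1, one_pow, mul_one] at hsum
    have : ∑ w ∈ fccSlots, ⟪G₀ w, e₃⟫_ℝ ^ 2 < ∑ _w ∈ fccSlots, (1 / 3 : ℝ) :=
      Finset.sum_lt_sum_of_nonempty (Finset.card_pos.1 (by rw [card_fccSlots]; norm_num)) hlt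
    rw [Finset.sum_const, card_fccSlots, nsmul_eq_mul, hsum] at this
    norm_num at this
  have hα : 0 < (G₀ u) 2 := lt_of_lt_of_le (by positivity) hu3
  -- the flux of the root slot beats `√(2/3)`: `√2 α ≥ √2/√3 = √6/3`
  have h63 : Real.sqrt 6 / 3 ≤ Real.sqrt 2 * (G₀ u) 2 := by
    have hs6 : Real.sqrt 6 / 3 = Real.sqrt 2 * (1 / Real.sqrt 3) := by
      have h3 : Real.sqrt 3 ≠ 0 := by positivity
      have h6 : Real.sqrt 6 = Real.sqrt 2 * Real.sqrt 3 := by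
        rw [← Real.sqrt_mul (by norm_num : (0 : ℝ) ≤ 2)]; norm_num
      field_simp
      rw [h6]; ring_nf; rw [Real.sq_sqrt (by norm_num : (0:ℝ) ≤ 3)]
    rw [hs6]
    exact mul_le_mul_of_nonneg_left hu3 (Real.sqrt_nonneg 2)
  -- the constant
  have hCE0 : (0 : ℝ) ≤ 12 * Real.sqrt 2 * Real.pi + 36 * 10 + 55440 := by positivity
  refine ⟨|C₁| + |C₂| + (240 * Real.sqrt 2 * Real.pi + 3120 * (4 * 10 + 2)) / 2 +
    (12 * Real.sqrt 2 * Real.pi + 36 * 10 + 55440) / 5720, 10, by norm_num, ?_⟩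
  intro h hh ρ hρ X P₁ P₂ hX hP₁X hP₂X₁ hcyl hP₁ hP₂
  set φ₁ : ℝ := Real.sqrt 2 / 4 * ∑ᶠ w ∈ {w ∈ fccStacking 1 (Real.sqrt (2 / 3)) | ‖w‖ = 1},
      |⟪w, A₁.symm e₃⟫_ℝ| with hφ₁
  set φ₂ : ℝ := Real.sqrt 2 / 4 * ∑ᶠ w ∈ {w ∈ fccStacking 1 (Real.sqrt (2 / 3)) | ‖w‖ = 1},
      |⟪w, A₂.symm e₃⟫_ℝ| with hφ₂
  have hP₂X : P₂ ⊆ X := hP₂X₁.trans sdiff_subset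
  have hρ0 : (0 : ℝ) ≤ ρ := by linarith
  -- (1) the two slab samples from above
  have hD₁ := hC₁ (-(2 * 10)) (-10) (by norm_num) ρ hρ P₁ hP₁
  have hD₂ := hC₂ (h + 10) (h + 2 * 10) (by ring) ρ hρ P₂ hP₂
  -- (2) the interior ledger
  have hled := ledger_ge_faces_add_interior A₁ t₁ A₂ t₂ X P₁ P₂ 10 h ρ le_rfl hh hρ hX hcyl hP₁X hP₂X
    hP₁ hP₂
  have hf₁ : Real.sqrt 2 / 4 * ∑ w ∈ fccSlots, |⟪A₁ w, e₃⟫_ℝ| = φ₁ := by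
    rw [hφ₁, finsum_unit_fcc_symm_eq_sum_slots]
  have hf₂ : Real.sqrt 2 / 4 * ∑ w ∈ fccSlots, |⟪A₂ w, e₃⟫_ℝ| = φ₂ := by
    rw [hφ₂, finsum_unit_fcc_symm_eq_sum_slots]
  rw [hf₁, hf₂, ← two_mul_contactDeficiency_eq_sum X] at hled
  -- (3) the payers of the interior window, fed by the root lines
  have hP₁' := hP₁
  have hP₂' := hP₂
  simp only [e₁, e₂] at hP₁' hP₂'
  have hpay : Real.sqrt 6 / 3 * Real.pi * ρ ^ 2 - (12 * Real.sqrt 2 * Real.pi + 36 * 10 + 55440) * ρ ≤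
      2860 * ((X.filter fun z => (X.filter fun q => dist z q = 1).card ≤ 11 ∧
        -10 - 2 ≤ z 2 ∧ z 2 ≤ h + 10 + 2).card : ℝ) := by
    have hcellpay := wordNet_trans_payers_ge_generic hg hc G₀ huS hα s₁ s₂ X P₁ P₂ 10 h ρ
      le_rfl hh hρ hX hcyl hP₁X hP₂X hP₁' hP₂' hgen'
    have hπρ : 0 ≤ Real.pi * ρ ^ 2 := by positivity
    have hflux' : Real.sqrt 6 / 3 * Real.pi * ρ ^ 2 ≤ Real.sqrt 2 * (G₀ u) 2 * Real.pi * ρ ^ 2 := by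
      have := mul_le_mul_of_nonneg_right h63 hπρ
      simp only [mul_assoc] at this ⊢
      exact this
    refine le_trans ?_ hcellpay
    linarith only [hflux']
  have hPAY : ((X.filter fun z => (X.filter fun q => dist z q = 1).card ≤ 11 ∧
        -10 - 2 ≤ z 2 ∧ z 2 ≤ h + 10 + 2).card : ℝ) ≤
      ((X.filter fun y => (X.filter fun q => dist y q = 1).card ≠ 12 ∧
        -10 - 2 ≤ y 2 ∧ y 2 ≤ h + 10 + 2).card : ℝ) := by
    exact_mod_cast card_le_card fun z hz => by
      rw [mem_filter] at hz ⊢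
      exact ⟨hz.1, by have := hz.2.1; omega, hz.2.2⟩
  -- (5) the two splits of the skeleton
  have hs₁ := contactDeficiency_sdiff_split hP₁X
  have hs₂ := contactDeficiency_sdiff_split hP₂X₁
  -- (6) assemble
  have ha : C₁ * ρ ≤ |C₁| * (1 + h) * ρ := by
    have h1 : C₁ * ρ ≤ |C₁| * ρ := mul_le_mul_of_nonneg_right (le_abs_self _) hρ0
    have h2 : 0 ≤ |C₁| * h * ρ := by positivity
    linarith only [h1, h2]
  have hb : C₂ * ρ ≤ |C₂| * (1 + h) * ρ := by
    have h1 : C₂ * ρ ≤ |C₂| * ρ := mul_le_mul_of_nonneg_right (le_abs_self _) hρ0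
    have h2 : 0 ≤ |C₂| * h * ρ := by positivity
    linarith only [h1, h2]
  have hCE : (12 * Real.sqrt 2 * Real.pi + 36 * 10 + 55440) * ρ ≤
      (12 * Real.sqrt 2 * Real.pi + 36 * 10 + 55440) * (1 + h) * ρ := by
    have := mul_nonneg (mul_nonneg hCE0 hh) hρ0
    linarith only [this]
  -- name the four counts
  set PAY : Finset (EuclideanSpace ℝ (Fin 3)) := X.filter fun z => (X.filter fun q => dist z q = 1).card ≤ 11 ∧
    -10 - 2 ≤ z 2 ∧ z 2 ≤ h + 10 + 2
  set PAY' : Finset (EuclideanSpace ℝ (Fin 3)) := X.filter fun y => (X.filter fun q => dist y q = 1).card ≠ 12 ∧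
    -10 - 2 ≤ y 2 ∧ y 2 ≤ h + 10 + 2
  have t1 : ((((P₁ ×ˢ (X \ P₁)).filter fun pq => dist pq.1 pq.2 = 1).card : ℕ) : ℝ) +
      ((((P₂ ×ˢ ((X \ P₁) \ P₂)).filter fun pq => dist pq.1 pq.2 = 1).card : ℕ) : ℝ) =
      contactDeficiency P₁ + contactDeficiency P₂ + contactDeficiency ((X \ P₁) \ P₂) -
        contactDeficiency X := by linarith only [hs₁, hs₂]
  have t2 : Real.sqrt 6 / 3 * Real.pi * ρ ^ 2 - (12 * Real.sqrt 2 * Real.pi + 36 * 10 + 55440) * ρ ≤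
      2860 * (PAY'.card : ℝ) := by
    linarith only [hpay, hPAY]
  have t3 : 2 * φ₁ * Real.pi * ρ ^ 2 + 2 * φ₂ * Real.pi * ρ ^ 2 + (PAY'.card : ℝ) -
      (240 * Real.sqrt 2 * Real.pi + 3120 * (4 * 10 + 2)) * (1 + h) * ρ ≤ 2 * contactDeficiency X := by
    linarith only [hled]
  have t4 : contactDeficiency P₁ ≤ 2 * φ₁ * Real.pi * ρ ^ 2 + C₁ * ρ := hD₁
  have t5 : contactDeficiency P₂ ≤ 2 * φ₂ * Real.pi * ρ ^ 2 + C₂ * ρ := hD₂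
  linarith only [t1, t2, t3, t4, t5, ha, hb, hCE]

end Summit.Ventures.Crystal3D.Theorems

end
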